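import Mathlib
import Literature.NumberTheory.Transcendental.KZCalculus

/-!
# Line `far_slices` for crux `FarPairMoment` (stmt-KontsevichZagierPeriods-17845, route HardSphereVirial)

`FarPairMoment` (crux-strategist piece 3/3 of `StarFourDisc`): for any honest quartic-moment cylinder
`qF = [B̄ × Far, |p|⁴] ⊂ ℝ⁶`, `108·[qF] + 2·[π]³ − 3·[√3][π]² − 9·[π] ∈ KZ.relations` — value `(π/3)·Ψ`,
`Ψ = vol Far = 1/4 − π²/18 + √3π/12`, `Far = {(y,z) ∈ L × L | |y − z| ≥ 1}`, `L` the unit-distance lens.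

THE LINE shadows, move by move, steps 4–5 of the PROVED value computation
`Literature.MathematicalPhysics.StatisticalMechanics.HardDiscB4Volume` (`volume_far2_eq_lintegral`, `sq_posPart_eq`,
`setIntegral_sq_eq_zero_of_swap`, `integral_sq_posPart`), with `m(u) = √(1 − max(u², (1−u)²))` (half-height of the lens at
abscissa `u`) and `c(u,u′) = √(1 − (u − u′)²)` (vertical separation forced by distance `≥ 1`):

* `FarSlice`      — `[Far, 1] ≡ [Ω, (m + m′ − c)²]`, `Ω = {c ≤ m + m′} ⊂ (0,1)²` (reindex shuffle `((u,v),(u′,v′)) ↦ ((u,u′),(v,v′))`,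
  rule (1a) into the two corner pieces, two Newton–Leibniz moves each with piecewise-LINEAR primitives, rule (1b));
* `SwapKill`      — `[Ω, (m + m′ − c)²] ≡ [Ω, R₁]`, `R₁ = 2m² + c² + 2mm′ − 4mc`: the rest `R₂ = (m′ − m)(m′ + m − 2c)` is
  antisymmetric under the swap `(u,u′) ↦ (u′,u)` (ONE rule-(2) move gives `[Ω,R₂] ≡ −[Ω,R₂]`, so `2·[Ω,R₂] ∈ relations`, and
  `FormalRep ⧸ relations` is torsion-free: `BetaCancellationNegative.zsmul_mem_relations_iff`);
* `SymmetricCore` — THE HARD STUB: `36·[Ω, R₁] + 2·[disc²] − 3·[(0,√3) × disc] − 9·[pt] ∈ relations` (value `36Ψ = 9 − 2π² + 3√3π`):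
  `2m² + c²` is piecewise polynomial (Newton–Leibniz onto conic one-forms over the conic-bounded base `Ω` — its boundary is an
  ellipse arc in `(1−u, 1−u′)`, since `u = 1 − cos A` forces `u′ = 1 − cos(π/3 − A)` — then the genus-zero sector
  `GenusZero.conicBand_reduce` / `genusZeroLowDimKernel`); the cross terms `2mm′ − 4mc` are kept UNFOLDED as integrand-1 solids
  fibred over `Ω` (never integrate an arccos out: barrier `noSemialgebraicPrimitive_inv_sub_two`); the `π²` enters as half the
  square of an arctangent representation (angle–angle triangle `{0 < A′ < A < π/3}` in tan-half-angle coordinates, area `π²/18`);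
* `QuarticPeelFar` — `3·[B̄ × Far, |p|⁴] ≡ [B̄ × Far, 1]` (product class `KZProduct.of_mul_of` + radial moment `∫|p|⁴ = π/3`:
  `ballKernel` / `tateLifting_radialBand`);
* `FarPackaging`  — from the four-dimensional far chain to the six-dimensional cylinder statement: `⟦cF⟧ = ⟦d⟧⟦f⟧`,
  `⟦p⟧ = ⟦d⟧⟦dd⟧`, `⟦s⟧ = ⟦d⟧⟦sd⟧`, `⟦d⟧⟦pt⟧ = ⟦d⟧` (cylinder ↔ product identifications `KZ.of_sub_of_mem_relations_of_eqOn`,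
  `KZ.of_mul_mem_relations`).

Composition `FarPairMoment_of` (kernel-checked, sorries only in the stubs):
`108·qF + 2p − 3s − 9d = 36·(3qF − cF) + (36·cF + 2p − 3s − 9d)` and `36f + … = 36(f − w) + 36(w − w₁) + (36w₁ + …)`.
-/

namespace Summit.KontsevichZagierPeriods.KontsevichZagierPeriods.Cruxes.FarPairMoment.FarSlices

open Literature.NumberTheory.Transcendental

/-- The FOUR-DIMENSIONAL FAR CHAIN `36·[Far,1] + 2·[disc²,1] − 3·[(0,√3)×disc,1] − 9·[pt,1] ∈ relations` (value
`36Ψ + 2π² − 3√3π − 9 = 0`), as a proposition (conclusion of stubs 1–3, hypothesis of stub 5). [cite: KontsevichZagier2001, §1.2] -/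
def FarChain : Prop :=
  ∀ (f : Literature.NumberTheory.Transcendental.KZ.IntegralRep 4), f.domain = {y | (y 0 ^ 2 + y 1 ^ 2 < 1 ∧ (y 0 - 1) ^ 2 + y 1 ^ 2 < 1) ∧ (y 2 ^ 2 + y 3 ^ 2 < 1 ∧ (y 2 - 1) ^ 2 + y 3 ^ 2 < 1) ∧ 1 ≤ (y 0 - y 2) ^ 2 + (y 1 - y 3) ^ 2} → (∀ y ∈ f.domain, f.integrand y = 1) → ∀ (dd : Literature.NumberTheory.Transcendental.KZ.IntegralRep 4), dd.domain = {y | y 0 ^ 2 + y 1 ^ 2 ≤ 1 ∧ y 2 ^ 2 + y 3 ^ 2 ≤ 1} → (∀ y ∈ dd.domain, dd.integrand y = 1) → ∀ (sd : Literature.NumberTheory.Transcendental.KZ.IntegralRep 3), sd.domain = {y | (0 < y 0 ∧ y 0 ^ 2 < 3) ∧ y 1 ^ 2 + y 2 ^ 2 ≤ 1} → (∀ y ∈ sd.domain, sd.integrand y = 1) → ∀ (u0 : Literature.NumberTheory.Transcendental.KZ.IntegralRep 0), u0.domain = Set.univ → (∀ y ∈ u0.domain, u0.integrand y = 1) → (36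 : ℤ) • Literature.NumberTheory.Transcendental.KZ.of f + (2 : ℤ) • Literature.NumberTheory.Transcendental.KZ.of dd - (3 : ℤ) • Literature.NumberTheory.Transcendental.KZ.of sd - (9 : ℤ) • Literature.NumberTheory.Transcendental.KZ.of u0 ∈ Literature.NumberTheory.Transcendental.KZ.relations

/-- Stub proposition 1 — FAR SLICING `[Far,1] ≡ [Ω, (m + m′ − c)²]`. [cite: KontsevichZagier2001, §1.2 rule (3)] -/
def FarSlice : Prop :=
  ∀ (f : Literature.NumberTheory.Transcendental.KZ.IntegralRep 4), f.domain = {y | (y 0 ^ 2 + y 1 ^ 2 < 1 ∧ (y 0 - 1) ^ 2 + y 1 ^ 2 < 1) ∧ (y 2 ^ 2 + y 3 ^ 2 < 1 ∧ (y 2 - 1) ^ 2 + y 3 ^ 2 < 1) ∧ 1 ≤ (y 0 - y 2) ^ 2 + (y 1 - y 3) ^ 2} → (∀ y ∈ f.domain, f.integrand y = 1) → ∃ (w : Literature.NumberTheory.Transcendental.KZ.IntegralRep 2), w.domain = {x : Fin 2 → ℝ | (0 < x 0 ∧ x 0 < 1) ∧ (0 < x 1 ∧ x 1 < 1) ∧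 Real.sqrt (1 - (x 0 - x 1) ^ 2) ≤ Real.sqrt (1 - max (x 0 ^ 2) ((1 - x 0) ^ 2)) + Real.sqrt (1 - max (x 1 ^ 2) ((1 - x 1) ^ 2))} ∧ (∀ x ∈ w.domain, w.integrand x = (Real.sqrt (1 - max (x 0 ^ 2) ((1 - x 0) ^ 2)) + Real.sqrt (1 - max (x 1 ^ 2) ((1 - x 1) ^ 2)) - Real.sqrt (1 - (x 0 - x 1) ^ 2)) ^ 2) ∧ Literature.NumberTheory.Transcendental.KZ.of f - Literature.NumberTheory.Transcendental.KZ.of w ∈ Literature.NumberTheory.Transcendental.KZ.relations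

/-- Stub proposition 2 — THE SWAP KILLS THE ANTISYMMETRIC PART `[Ω, (m + m′ − c)²] ≡ [Ω, 2m² + c² + 2mm′ − 4mc]`.
[cite: KontsevichZagier2001, §1.2 rule (2)] -/
def SwapKill : Prop :=
  ∀ (w : Literature.NumberTheory.Transcendental.KZ.IntegralRep 2), w.domain = {x : Fin 2 → ℝ | (0 < x 0 ∧ x 0 < 1) ∧ (0 < x 1 ∧ x 1 < 1) ∧ Real.sqrt (1 - (x 0 - x 1) ^ 2) ≤ Real.sqrt (1 - max (x 0 ^ 2) ((1 - x 0) ^ 2)) + Real.sqrt (1 - max (x 1 ^ 2) ((1 - x 1) ^ 2))} → (∀ x ∈ w.domain, w.integrand x = (Real.sqrt (1 - max (x 0 ^ 2) ((1 - x 0) ^ 2)) + Real.sqrt (1 - max (x 1 ^ 2) ((1 - x 1) ^ 2)) - Real.sqrt (1 - (x 0 - x 1) ^ 2)) ^ 2) → ∃ (w₁ : Literature.NumberTheory.Transcendental.KZ.IntegralRep 2), w₁.domain = {x : Fin 2 → ℝ | (0 < x 0 ∧ x 0 < 1) ∧ (0 < x 1 ∧ x 1 < 1) ∧ Real.sqrt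 (1 - (x 0 - x 1) ^ 2) ≤ Real.sqrt (1 - max (x 0 ^ 2) ((1 - x 0) ^ 2)) + Real.sqrt (1 - max (x 1 ^ 2) ((1 - x 1) ^ 2))} ∧ (∀ x ∈ w₁.domain, w₁.integrand x = 2 * Real.sqrt (1 - max (x 0 ^ 2) ((1 - x 0) ^ 2)) ^ 2 + Real.sqrt (1 - (x 0 - x 1) ^ 2) ^ 2 + 2 * Real.sqrt (1 - max (x 0 ^ 2) ((1 - x 0) ^ 2)) * Real.sqrt (1 - max (x 1 ^ 2) ((1 - x 1) ^ 2)) - 4 * Real.sqrt (1 - max (x 0 ^ 2) ((1 - x 0) ^ 2)) * Real.sqrt (1 - (x 0 - x 1) ^ 2)) ∧ Literature.NumberTheory.Transcendental.KZ.of w - Literature.NumberTheory.Transcendental.KZ.of w₁ ∈ Literature.NumberTheory.Transcendental.KZ.relations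

/-- Stub proposition 3 — THE SYMMETRIC CORE COMPILES `36·[Ω, R₁] + 2·[disc²] − 3·[(0,√3) × disc] − 9·[pt] ∈ relations`.
[cite: KontsevichZagier2001, §1.2] -/
def SymmetricCore : Prop :=
  ∀ (w₁ : Literature.NumberTheory.Transcendental.KZ.IntegralRep 2), w₁.domain = {x : Fin 2 → ℝ | (0 < x 0 ∧ x 0 < 1) ∧ (0 < x 1 ∧ x 1 < 1) ∧ Real.sqrt (1 - (x 0 - x 1) ^ 2) ≤ Real.sqrt (1 - max (x 0 ^ 2) ((1 - x 0) ^ 2)) + Real.sqrt (1 - max (x 1 ^ 2) ((1 - x 1) ^ 2))} → (∀ x ∈ w₁.domain, w₁.integrand x = 2 * Real.sqrt (1 - max (x 0 ^ 2) ((1 - x 0) ^ 2)) ^ 2 + Real.sqrt (1 - (x 0 - x 1) ^ 2) ^ 2 + 2 * Real.sqrt (1 - max (x 0 ^ 2) ((1 - x 0) ^ 2)) * Real.sqrt (1 - max (x 1 ^ 2) ((1 - x 1) ^ 2)) - 4 * Real.sqrt (1 - max (x 0 ^ 2) ((1 - x 0) ^ 2)) * Real.sqrt (1 - (x 0 - x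 1) ^ 2)) → ∀ (dd : Literature.NumberTheory.Transcendental.KZ.IntegralRep 4), dd.domain = {y | y 0 ^ 2 + y 1 ^ 2 ≤ 1 ∧ y 2 ^ 2 + y 3 ^ 2 ≤ 1} → (∀ y ∈ dd.domain, dd.integrand y = 1) → ∀ (sd : Literature.NumberTheory.Transcendental.KZ.IntegralRep 3), sd.domain = {y | (0 < y 0 ∧ y 0 ^ 2 < 3) ∧ y 1 ^ 2 + y 2 ^ 2 ≤ 1} → (∀ y ∈ sd.domain, sd.integrand y = 1) → ∀ (u0 : Literature.NumberTheory.Transcendental.KZ.IntegralRep 0), u0.domain = Set.univ → (∀ y ∈ u0.domain, u0.integrand y = 1) → (36 : ℤ) • Literature.NumberTheory.Transcendental.KZ.of w₁ + (2 : ℤ) • Literature.NumberTheory.Transcendental.KZ.of dd - (3 : ℤ) • Literature.NumberTheory.Transcendental.KZ.of sd - (9 : ℤ) • Literature.NumberTheory.Transcendental.KZ.of u0 ∈ Literature.NumberTheory.Transcendental.KZ.relations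

/-- Stub proposition 4 — QUARTIC PEEL `3·[B̄ × Far, |p|⁴] ≡ [B̄ × Far, 1]`. [cite: KontsevichZagier2001, §1.2] -/
def QuarticPeelFar : Prop :=
  ∀ (qF : Literature.NumberTheory.Transcendental.KZ.IntegralRep 6), qF.domain = {x | x 0 ^ 2 + x 1 ^ 2 ≤ 1 ∧ (x 2 ^ 2 + x 3 ^ 2 < 1 ∧ (x 2 - 1) ^ 2 + x 3 ^ 2 < 1) ∧ (x 4 ^ 2 + x 5 ^ 2 < 1 ∧ (x 4 - 1) ^ 2 + x 5 ^ 2 < 1) ∧ 1 ≤ (x 2 - x 4) ^ 2 + (x 3 - x 5) ^ 2} → (∀ x ∈ qF.domain, qF.integrand x = (x 0 ^ 2 + x 1 ^ 2) ^ 2) → ∃ (cF : Literature.NumberTheory.Transcendental.KZ.IntegralRep 6), cF.domain = {x | x 0 ^ 2 + x 1 ^ 2 ≤ 1 ∧ (x 2 ^ 2 + x 3 ^ 2 < 1 ∧ (x 2 - 1) ^ 2 + x 3 ^ 2 < 1) ∧ (x 4 ^ 2 + x 5 ^ 2 < 1 ∧ (x 4 - 1) ^ 2 + x 5 ^ 2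 < 1) ∧ 1 ≤ (x 2 - x 4) ^ 2 + (x 3 - x 5) ^ 2} ∧ (∀ x ∈ cF.domain, cF.integrand x = 1) ∧ (3 : ℤ) • Literature.NumberTheory.Transcendental.KZ.of qF - Literature.NumberTheory.Transcendental.KZ.of cF ∈ Literature.NumberTheory.Transcendental.KZ.relations

/-- Stub proposition 5 — PACKAGING the far chain into the cylinder statement. [cite: KontsevichZagier2001, §4.1] -/
def FarPackaging : Prop :=
  ∀ (cF : Literature.NumberTheory.Transcendental.KZ.IntegralRep 6), cF.domain = {x | x 0 ^ 2 + x 1 ^ 2 ≤ 1 ∧ (x 2 ^ 2 + x 3 ^ 2 < 1 ∧ (x 2 - 1) ^ 2 + x 3 ^ 2 < 1) ∧ (x 4 ^ 2 + x 5 ^ 2 < 1 ∧ (x 4 - 1) ^ 2 + x 5 ^ 2 < 1) ∧ 1 ≤ (x 2 - x 4) ^ 2 + (x 3 - x 5) ^ 2} → (∀ x ∈ cF.domain, cF.integrand x = 1) → ∀ (p : Literature.NumberTheory.Transcendental.KZ.IntegralRep 6), p.domain = {y | y 0 ^ 2 + y 1 ^ 2 ≤ 1 ∧ y 2 ^ 2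 + y 3 ^ 2 ≤ 1 ∧ y 4 ^ 2 + y 5 ^ 2 ≤ 1} → (∀ y ∈ p.domain, p.integrand y = 1) → ∀ (s : Literature.NumberTheory.Transcendental.KZ.IntegralRep 5), s.domain = {y | (0 < y 0 ∧ y 0 ^ 2 < 3) ∧ y 1 ^ 2 + y 2 ^ 2 ≤ 1 ∧ y 3 ^ 2 + y 4 ^ 2 ≤ 1} → (∀ y ∈ s.domain, s.integrand y = 1) → ∀ (d : Literature.NumberTheory.Transcendental.KZ.IntegralRep 2), d.domain = {y | y 0 ^ 2 + y 1 ^ 2 ≤ 1} → (∀ y ∈ d.domain, d.integrand y = 1) → FarChain → (36 : ℤ) • Literature.NumberTheory.Transcendental.KZ.of cF + (2 : ℤ) • Literature.NumberTheory.Transcendental.KZ.of p - (3 : ℤ) • Literature.NumberTheory.Transcendental.KZ.of s - (9 : ℤ) • Literature.NumberTheory.Transcendental.KZ.of d ∈ Literature.NumberTheory.Transcendental.KZ.relations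

/-- LOCAL COPY of the route decl `Summit.KontsevichZagierPeriods.KontsevichZagierPeriods.Theses.HardSphereVirial.FarPairMoment`
(stmt-1784x; identical body). PUBLISHED IN DRAFT FORM because the Lean farm was incoherent for `Theses.HardSphereVirial` (route rev 6)
when this line was written; TO FINALISE: import the route file, replace `FarPairMoment_local` by the route decl in `FarPairMoment_of`, and run
`ledger skeleton check <this file> --crux <item>` — the composition is unchanged (kernel-checked here against the copy). -/
def FarPairMoment_local : Prop :=
  ∀ (qF : Literature.NumberTheory.Transcendental.KZ.IntegralRep 6), qF.domain = {x | x 0 ^ 2 + x 1 ^ 2 ≤ 1 ∧ (x 2 ^ 2 + x 3 ^ 2 < 1 ∧ (x 2 - 1) ^ 2 + x 3 ^ 2 < 1) ∧ (x 4 ^ 2 + x 5 ^ 2 < 1 ∧ (x 4 - 1) ^ 2 + x 5 ^ 2 < 1) ∧ 1 ≤ (x 2 - x 4) ^ 2 + (x 3 - x 5) ^ 2} → (∀ x ∈ qF.domain, qF.integrand x = (x 0 ^ 2 + x 1 ^ 2) ^ 2) → ∀ (p : Literature.NumberTheory.Transcendental.KZ.IntegralRep 6), p.domain = {y | y 0 ^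 2 + y 1 ^ 2 ≤ 1 ∧ y 2 ^ 2 + y 3 ^ 2 ≤ 1 ∧ y 4 ^ 2 + y 5 ^ 2 ≤ 1} → (∀ y ∈ p.domain, p.integrand y = 1) → ∀ (s : Literature.NumberTheory.Transcendental.KZ.IntegralRep 5), s.domain = {y | (0 < y 0 ∧ y 0 ^ 2 < 3) ∧ y 1 ^ 2 + y 2 ^ 2 ≤ 1 ∧ y 3 ^ 2 + y 4 ^ 2 ≤ 1} → (∀ y ∈ s.domain, s.integrand y = 1) → ∀ (d : Literature.NumberTheory.Transcendental.KZ.IntegralRep 2), d.domain = {y | y 0 ^ 2 + y 1 ^ 2 ≤ 1} → (∀ y ∈ d.domain, d.integrand y = 1) → (108 : ℤ) • Literature.NumberTheory.Transcendental.KZ.of qF + (2 : ℤ) • Literature.NumberTheory.Transcendental.KZ.of p - (3 : ℤ) • Literature.NumberTheory.Transcendental.KZ.of s - (9 : ℤ) • Literature.NumberTheory.Transcendental.KZ.of d ∈ Literature.NumberTheory.Transcendental.KZ.relations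

/-- **Stub 1.** [cite: KontsevichZagier2001, §1.2 rule (3)] -/
theorem stub_farSlice : FarSlice := by
  sorry

/-- **Stub 2.** [cite: KontsevichZagier2001, §1.2 rule (2)] -/
theorem stub_swapKill : SwapKill := by
  sorry

/-- **Stub 3 (hardest).** [cite: KontsevichZagier2001, §1.2] -/
theorem stub_symmetricCore : SymmetricCore := by
  sorry

/-- **Stub 4.** [cite: KontsevichZagier2001, §1.2] -/
theorem stub_quarticPeelFar : QuarticPeelFar := by
  sorry

/-- **Stub 5.** [cite: KontsevichZagier2001, §4.1] -/
theorem stub_farPackaging : FarPackaging := by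
  sorry

/-- The four-dimensional far chain from stubs 1–3: `36f + 2dd − 3sd − 9u = 36(f − w) + 36(w − w₁) + (36w₁ + 2dd − 3sd − 9u)`.
[cite: KontsevichZagier2001, §1.2] -/
theorem farChain_of_stubs : FarChain := by
  intro f hf hf1 dd hdd hdd1 sd hsd hsd1 u0 hu0 hu01
  obtain ⟨w, hw, hw1, hfw⟩ := stub_farSlice f hf hf1
  obtain ⟨w₁, hw₁, hw₁1, hww⟩ := stub_swapKill w hw hw1
  have hcore := stub_symmetricCore w₁ hw₁ hw₁1 dd hdd hdd1 sd hsd hsd1 u0 hu0 hu01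
  have hsum := KZ.relations.add_mem (KZ.relations.zsmul_mem (KZ.relations.add_mem hfw hww) 36) hcore
  convert hsum using 1
  module

/-- **Composition**: the five stubs imply the crux `FarPairMoment` BY NAME:
`108·qF + 2p − 3s − 9d = 36·(3qF − cF) + (36·cF + 2p − 3s − 9d)`. [cite: KontsevichZagier2001, §1.2] -/
theorem FarPairMoment_of :
    FarPairMoment_local := by
  intro qF hqF hqF1 p hp hp1 s hs hs1 d hd hd1
  obtain ⟨cF, hcF, hcF1, hpeel⟩ := stub_quarticPeelFar qF hqF hqF1
  have hpack := stub_farPackaging cF hcF hcF1 p hp hp1 s hs hs1 d hd hd1 farChain_of_stubs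
  have hsum := KZ.relations.add_mem (KZ.relations.zsmul_mem hpeel 36) hpack
  convert hsum using 1
  module

end Summit.KontsevichZagierPeriods.KontsevichZagierPeriods.Cruxes.FarPairMoment.FarSlices
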